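import Summits.AtomisticToContinuum.Crystallization.Theses.ThreeConeCertificate
import Summits.AtomisticToContinuum.Crystallization.Theorems.ThreeConeCertificateOnePercentCertificateReduction
import Summits.AtomisticToContinuum.Crystallization.Theorems.ThreeConeCertificateTwoConeTools
import Literature.MathematicalPhysics.StatisticalMechanics.HardCoreGSC
import Literature.Geometry.DiscreteGeometry.KissingPatterns
import Literature.Geometry.DiscreteGeometry.KissingRigidity
import Literature.Barriers.AtomisticToContinuum.IcosahedralClusters

/-!
# `OnePercentCertificate` (stmt-AtomisticToContinuum-11958) / Negative: the local constant `stub_local`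
of line `Sketch` — load-bearing hypotheses and the failure of the one-centre strategy

Negative knowledge for the crux's only open obligation (crux-disprover seat, gen 2, 2026-08-16; work file
`Cruxes/OnePercentCertificate/Disproof.lean`).  By `OnePercentReduction.onePercentCertificate_of_local`
the crux follows from ONE statement about the tree split of `ThreeConeCertificateDefs.lean`:
`stub_local : ∀ N x, Injective x → −(cS·N) ≤ Σ_{i<j} gS(|x_i − x_j|)` (`cS = 29/40 − fS 0/2`).  Nothing here
closes an item; every Prop is inlined (no definitions, no notation).

* exact constants: `fS 0 = 67013/500000`, `cS = 657987/1000000` (`bernsteinTail T 0 = T³/3`);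
  `gS 0 = −fS 0` (junk value, `V_LJ 0 = 0`); `gS 1 ≤ −93/1000` (certified with the `TwoConeTools` exp
  brackets; `gS 1 = −0.0932126`).
* `false_without_injective` — with injectivity dropped the stub is false (`11` coincident points:
  `55·gS 0 = −7.37 < −11·cS`): any proof uses `0 < dist`, i.e. injectivity.
* `withoutStability` — at crux level, decomposition, slack sign, range `5/2`, positive type AND the value
  `29/40` are met simultaneously by `(cS, gS, US, fS)`: with the gen-1 lemmas (`…withoutRange_iff`, the
  trivial cone-free variants) the `c`-stability of the range-`5/2` part is the crux's ENTIRE content.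
* `of_hardCoreSiteBound` / `not_hardCoreSiteBound` — the plain ONE-CENTRE strategy (a pointwise site bound
  `Σ_{j≠i} gS(r_ij) ≥ −2 cS` on `δ`-separated configurations, which sums to the stub) is FALSE for every hard
  core `δ ≤ 9/10`: by the generic `exists_star_of_shell` (a shell of `n` rational unit vectors pairwise
  `≥ p/q` apart gives a `p/q`-separated star whose centre has site energy `n · gS 1`) and an explicit rational
  approximant of the Tammes `15`-point code (min chord `0.90205`; Tammes optimum `0.90272`), a `9/10`-separated
  sixteen-point configuration has centre site energy `15·gS 1 ≤ −1.395 < −2 cS = −1.315974`.  Numerically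
  (seat folder `numerics/star/star2.py`) the relaxation value stays below `−2 cS` up to `δ = 0.95` (`≤ −1.384`:
  fourteen neighbours at `1.017` plus a second shell near `1.6`) and is found `≈ −1.3085 > −2 cS` only at
  `δ = 0.97`, the nearest-neighbour distance of the `gS`-optimal close packing itself (`0.9712`,
  `e_gS(hcp) = −0.651259`): no provable hard core rescues a transfer-free one-centre certificate of `stub_local`.
-/

noncomputable section

namespace Summit.AtomisticToContinuum.Crystallization.Theorems.StubLocal

open scoped BigOperators
open MeasureTheory intervalIntegral
open Literature.MathematicalPhysics.StatisticalMechanics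
open Literature.Geometry.DiscreteGeometry
open Summit.AtomisticToContinuum.Crystallization.Theorems
open Summit.AtomisticToContinuum.Crystallization.Theorems.ThreeConeSplit

/-! ### Exact constants of the split -/

/-- `bernsteinTail T 0 = T³/3`. [folklore] -/
theorem bernsteinTail_zero (T : ℝ) : bernsteinTail T 0 = T ^ 3 / 3 := by
  simp [bernsteinTail, integral_pow]
  norm_num

/-- `fS 0 = A − B − T³/36 = 67013/500000 = 0.134026` exactly. [folklore] -/
theorem fS_zero : fS 0 = 67013 / 500000 := by
  rw [fS, bernsteinTail_zero]
  norm_num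

/-- `cS = 29/40 − fS 0/2 = 657987/1000000` exactly. [folklore] -/
theorem cS_eq : cS = 657987 / 1000000 := by
  rw [cS, fS_zero]
  norm_num

/-- Junk value at coincident points: `gS 0 = −fS 0 < 0` (Lean's `0⁻¹ = 0` gives `V_LJ 0 = 0`). [folklore] -/
theorem gS_zero : gS 0 = -(67013 / 500000) := by
  rw [gS, if_pos (by norm_num : (0 : ℝ) < 5 / 2), lennardJones_zero, fS_zero]
  ring

/-- `gS 1 ≤ −0.093` (`gS 1 = −1/12 − fS 1 = −0.0932126`), from the rational exp brackets of
`TwoConeTools` at `q = 169/100, 81/100, 36/25`. [folklore] -/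
theorem gS_one_le : gS 1 ≤ -(93 / 1000) := by
  have hL1 : (1845195239 / 10000000000 : ℝ) ≤ Real.exp (-(169 / 100)) :=
    TwoConeTools.le_exp_neg_of_bracket 1 (69 / 100) (169 / 100) _ (by norm_num) (by norm_num) (by norm_num)
      (by norm_num)
  have hU2 : Real.exp (-(81 / 100)) ≤ (4448580663 / 10000000000 : ℝ) :=
    TwoConeTools.exp_neg_le_of_bracket 0 (81 / 100) (81 / 100) _ (by norm_num) (by norm_num) (by norm_num)
      (by norm_num)
  have hL3 : (1184638793 / 5000000000 : ℝ) ≤ Real.exp (-(36 / 25)) :=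
    TwoConeTools.le_exp_neg_of_bracket 1 (44 / 100) (36 / 25) _ (by norm_num) (by norm_num) (by norm_num)
      (by norm_num)
  have hgS : gS 1 = lennardJones 1 - fS 1 := by
    rw [gS, if_pos (by norm_num : (1 : ℝ) < 5 / 2)]
  have hbt : bernsteinTail (36 / 25) 1 =
      2 / (1 : ℝ) ^ 6 * (1 - Real.exp (-(36 / 25) * (1 : ℝ) ^ 2) *
        (1 + 36 / 25 * (1 : ℝ) ^ 2 + (36 / 25 * (1 : ℝ) ^ 2) ^ 2 / 2)) :=
    stub_bernsteinTail_eq (36 / 25) 1 (by norm_num) one_pos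
  rw [hgS, lennardJones_one, fS, hbt]
  have e1 : Real.exp (-(169 / 100) * (1 : ℝ) ^ 2) = Real.exp (-(169 / 100)) := by norm_num
  have e2 : Real.exp (-(81 / 100) * (1 : ℝ) ^ 2) = Real.exp (-(81 / 100)) := by norm_num
  have e3 : Real.exp (-(36 / 25) * (1 : ℝ) ^ 2) = Real.exp (-(36 / 25)) := by norm_num
  rw [e1, e2, e3]
  nlinarith [hL1, hU2, hL3]

/-! ### Injectivity is load-bearing (junk model) -/

/-- **`stub_local` without `Function.Injective x` is false**: `11` coincident points have `gS`-energy
`55 · gS 0 = −7.37 < −11·cS = −7.24`.  So any proof of the stub must use injectivity (through `0 < dist`),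
exactly as the crux's stability clause does. [folklore] -/
theorem false_without_injective :
    ¬ ∀ (N : ℕ) (x : Fin N → EuclideanSpace ℝ (Fin 3)), -(cS * (N : ℝ)) ≤ interactionEnergy gS x := by
  intro h
  have h11 := h 11 (fun _ => 0)
  have h2 := two_mul_interactionEnergy_eq_sum_sum_sub gS (fun _ : Fin 11 => (0 : EuclideanSpace ℝ (Fin 3)))
  simp only [dist_self, Finset.sum_const, Finset.card_univ, Fintype.card_fin, nsmul_eq_mul,
    Nat.cast_ofNat] at h2
  rw [gS_zero] at h2
  rw [cS_eq] at h11
  norm_num at h11 h2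
  linarith

/-! ### Crux level: stability is the whole content -/

/-- **Every hypothesis of `OnePercentCertificate` except `c`-stability is met simultaneously by the tree
split `(cS, gS, US, fS)`** — decomposition on `(0,∞)`, slack sign, range `5/2`, positive type
(`OnePercentReduction.fS_posType`) and the value `c + f 0/2 ≤ 29/40` (with equality).  Together with
`onePercentCertificate_withoutRange_iff` and the trivial cone-free variants of the gen-1 file, this completes
the load-bearing table: the stability constant of a range-`5/2` part is the crux's entire content, and for
this split it is exactly `stub_local`. [folklore] -/
theorem withoutStability :
    ∃ (c : ℝ) (g U f : ℝ → ℝ), (∀ r : ℝ, 0 < r → lennardJones r = g r + U r + f r) ∧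
      (∀ r : ℝ, 0 < r → 0 ≤ U r) ∧ (∀ r : ℝ, 5 / 2 ≤ r → g r = 0) ∧
      (∀ (n : ℕ) (y : Fin n → EuclideanSpace ℝ (Fin 3)) (w : Fin n → ℝ), 0 ≤ ∑ i, ∑ j, w i * w j * f (dist (y i) (y j))) ∧
      c + f 0 / 2 ≤ 29 / 40 := by
  refine ⟨cS, gS, US, fS, fun r _ => lennardJones_eq_gS_add_US_add_fS r, ?_, fun r hr => gS_eq_zero hr,
    OnePercentReduction.fS_posType, (cS_add_fS_zero_div_two).le⟩
  intro r _
  simp only [US]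
  split_ifs with h
  · exact le_rfl
  · exact sub_nonneg.2 (OnePercentReduction.fS_le_lennardJones r (not_lt.1 h))

/-! ### The one-centre strategy under a hard core -/

/-- A pointwise site bound `Σ_{j≠i} gS(r_ij) ≥ −2·cS` on `δ`-separated configurations sums
(`2 Σ_{i<j} = Σ_i Σ_{j≠i}`) to `stub_local` on those configurations: this is how a one-centre certificate
would be used (after a minimal-distance lemma for near-minimisers of the `gS`-energy). [folklore] -/
theorem of_hardCoreSiteBound {δ : ℝ}
    (h : ∀ (N : ℕ) (x : Fin N → EuclideanSpace ℝ (Fin 3)), Function.Injective x → (∀ i j, i ≠ j → δ ≤ dist (x i) (x j)) →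
      ∀ i, -(2 * cS) ≤ siteEnergy gS x i)
    (N : ℕ) (x : Fin N → EuclideanSpace ℝ (Fin 3)) (hx : Function.Injective x) (hsep : ∀ i j, i ≠ j → δ ≤ dist (x i) (x j)) :
    -(cS * (N : ℝ)) ≤ interactionEnergy gS x := by
  have h2 := two_mul_interactionEnergy gS x
  have hs : ∑ _i : Fin N, (-(2 * cS)) ≤ ∑ i, siteEnergy gS x i :=
    Finset.sum_le_sum fun i _ => h N x hx hsep i
  rw [Finset.sum_const, Finset.card_univ, Fintype.card_fin, nsmul_eq_mul] at hs
  linarith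

/-! #### Generic rational stars: a shell of integer vectors `v i` on the spheres `|v i|² = (d i)²`, scaled to
unit vectors `(d i)⁻¹ • v i`, with pairwise separation certified in integers -/

/-- A scaled integer vector `d⁻¹ • v` with `|v|² = d²` is a unit vector. [folklore] -/
theorem norm_smul_intVec_eq_one {v : Fin 3 → ℤ} {d : ℕ} (hd : 0 < d) (hv : sqNormInt v = (d : ℤ) ^ 2) :
    ‖((d : ℝ))⁻¹ • intVec v‖ = 1 := by
  have hdR : (0 : ℝ) < d := by exact_mod_cast hd
  rw [norm_smul, norm_inv, Real.norm_of_nonneg hdR.le, norm_intVec, hv]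
  push_cast
  rw [Real.sqrt_sq hdR.le, inv_mul_cancel₀ hdR.ne']

/-- Separation of two scaled integer vectors from the integer inequality
`p²·d²·e² ≤ q²·|e v − d w|²`: then `p/q ≤ |d⁻¹ v − e⁻¹ w|`. [folklore] -/
theorem div_le_dist_smul_intVec {v w : Fin 3 → ℤ} {d e : ℕ} (hd : 0 < d) (he : 0 < e) {p q : ℕ} (hq : 0 < q)
    (hsep : (p : ℤ) ^ 2 * ((d : ℤ) ^ 2 * (e : ℤ) ^ 2) ≤ (q : ℤ) ^ 2 * sqNormInt ((e : ℤ) • v - (d : ℤ) • w)) :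
    (p : ℝ) / q ≤ dist (((d : ℝ))⁻¹ • intVec v : EuclideanSpace ℝ (Fin 3)) (((e : ℝ))⁻¹ • intVec w) := by
  have hdR : (0 : ℝ) < d := by exact_mod_cast hd
  have heR : (0 : ℝ) < e := by exact_mod_cast he
  have hqR : (0 : ℝ) < q := by exact_mod_cast hq
  have hsepR : (p : ℝ) ^ 2 * ((d : ℝ) ^ 2 * (e : ℝ) ^ 2) ≤
      (q : ℝ) ^ 2 * (sqNormInt ((e : ℤ) • v - (d : ℤ) • w) : ℝ) := by
    exact_mod_cast hsep
  set S : ℝ := (sqNormInt ((e : ℤ) • v - (d : ℤ) • w) : ℝ) with hS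
  have hdiff : (((d : ℝ))⁻¹ • intVec v : EuclideanSpace ℝ (Fin 3)) - ((e : ℝ))⁻¹ • intVec w =
      (((d : ℝ) * (e : ℝ)))⁻¹ • intVec ((e : ℤ) • v - (d : ℤ) • w) := by
    rw [← intVec_sub, intVec_zsmul, intVec_zsmul, smul_sub, smul_smul, smul_smul]
    congr 1
    · rw [mul_inv, Int.cast_natCast, mul_assoc, inv_mul_cancel₀ heR.ne', mul_one]
    · rw [mul_inv, Int.cast_natCast, mul_comm ((d : ℝ))⁻¹, mul_assoc, inv_mul_cancel₀ hdR.ne', mul_one]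
  rw [dist_eq_norm, hdiff, norm_smul, norm_inv, Real.norm_of_nonneg (mul_pos hdR heR).le, norm_intVec, ← hS,
    le_inv_mul_iff₀ (mul_pos hdR heR), div_eq_mul_inv]
  have hsq : ((d : ℝ) * (e : ℝ) * ((p : ℝ) * (q : ℝ)⁻¹)) ^ 2 ≤ S := by
    have hq2 : (0 : ℝ) < (q : ℝ) ^ 2 := by positivity
    rw [show ((d : ℝ) * (e : ℝ) * ((p : ℝ) * (q : ℝ)⁻¹)) ^ 2 = (p : ℝ) ^ 2 * ((d : ℝ) ^ 2 * (e : ℝ) ^ 2) / (q : ℝ) ^ 2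
      by field_simp]
    rw [div_le_iff₀ hq2]
    linarith [hsepR]
  calc (d : ℝ) * (e : ℝ) * ((p : ℝ) * (q : ℝ)⁻¹)
        = Real.sqrt (((d : ℝ) * (e : ℝ) * ((p : ℝ) * (q : ℝ)⁻¹)) ^ 2) := (Real.sqrt_sq (by positivity)).symm
    _ ≤ Real.sqrt S := Real.sqrt_le_sqrt hsq

/-- **Stars from rational shells.**  Integer vectors `v i` with `|v i|² = (d i)²` and the integer separation
`p²·(d i)²·(d j)² ≤ q²·|d j • v i − d i • v j|²` (`i ≠ j`, `p ≤ q`) give the configuration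
"centre `0` + the `n` unit vectors `(d i)⁻¹ v i`": injective, `p/q`-separated, and with centre `gS`-site
energy `n · gS 1` (every shell point is at distance exactly `1`). [folklore] -/
theorem exists_star_of_shell {n : ℕ} (v : Fin n → Fin 3 → ℤ) (d : Fin n → ℕ) {p q : ℕ} (hq : 0 < q)
    (hp : 0 < p) (hpq : p ≤ q) (hd : ∀ i, 0 < d i) (hv : ∀ i, sqNormInt (v i) = (d i : ℤ) ^ 2)
    (hsep : ∀ i j, i ≠ j → (p : ℤ) ^ 2 * ((d i : ℤ) ^ 2 * (d j : ℤ) ^ 2) ≤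
      (q : ℤ) ^ 2 * sqNormInt ((d j : ℤ) • v i - (d i : ℤ) • v j)) :
    ∃ x : Fin (n + 1) → EuclideanSpace ℝ (Fin 3), Function.Injective x ∧ (∀ i j, i ≠ j → (p : ℝ) / q ≤ dist (x i) (x j)) ∧
      siteEnergy gS x 0 = n * gS 1 := by
  set x : Fin (n + 1) → EuclideanSpace ℝ (Fin 3) := Fin.cons (0 : EuclideanSpace ℝ (Fin 3)) (fun i => ((d i : ℝ))⁻¹ • intVec (v i)) with hx
  have hx0 : x 0 = 0 := by simp [hx]
  have hxs : ∀ i : Fin n, x i.succ = ((d i : ℝ))⁻¹ • intVec (v i) := fun i => by simp [hx]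
  have hdist0 : ∀ i : Fin n, dist (x 0) (x i.succ) = 1 := fun i => by
    rw [hx0, hxs, dist_comm, dist_zero_right, norm_smul_intVec_eq_one (hd i) (hv i)]
  have hpq1 : (p : ℝ) / q ≤ 1 := by
    rw [div_le_one (by exact_mod_cast hq)]
    exact_mod_cast hpq
  have hpq0 : (0 : ℝ) < (p : ℝ) / q := by positivity
  have hsepx : ∀ i j, i ≠ j → (p : ℝ) / q ≤ dist (x i) (x j) := by
    intro i j hij
    induction i using Fin.cases with
    | zero =>
      induction j using Fin.cases with
      | zero => exact absurd rfl hij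
      | succ j => rw [hdist0]; exact hpq1
    | succ i =>
      induction j using Fin.cases with
      | zero => rw [dist_comm, hdist0]; exact hpq1
      | succ j =>
        rw [hxs, hxs]
        exact div_le_dist_smul_intVec (hd i) (hd j) hq (hsep i j fun h => hij (by rw [h]))
  refine ⟨x, ?_, hsepx, ?_⟩
  · intro i j h
    by_contra hij
    have := hsepx i j hij
    rw [h, dist_self] at this
    linarith
  · unfold siteEnergy
    have h : ∀ j ∈ Finset.univ.erase (0 : Fin (n + 1)), gS (dist (x 0) (x j)) = gS 1 := by
      intro j hj
      obtain ⟨i, rfl⟩ := Fin.exists_succ_eq.2 (Finset.ne_of_mem_erase hj)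
      rw [hdist0]
    rw [Finset.sum_congr rfl h, Finset.sum_const, Finset.card_erase_of_mem (Finset.mem_univ _),
      Finset.card_univ, Fintype.card_fin, nsmul_eq_mul]
    push_cast
    ring

/-- **The one-centre site bound is false up to hard core `9/10`.**  Witness: `exists_star_of_shell` with the
fifteen rational unit vectors below (a rational approximant of the Tammes `15`-point code: min chord `0.90205`,
all integer checks by `decide`), whose centre has `gS`-site energy `15 · gS 1 ≤ −1.395 < −2·cS = −1.315974`;
fifteen unit-distance neighbours fit because the Tammes number of `15` points is `0.9027 > 9/10`.  Any
one-centre certification of `stub_local` must therefore first establish a hard core `> 9/10` for the competing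
configurations (Yuhjtman-type minimal-distance lemmas give `≈ 0.7`; the relaxation is numerically still violated
at `0.95` and only marginally satisfied at `0.97 ≈` the optimal nearest-neighbour distance itself) or transfer
energy between centres. [folklore] -/
theorem not_hardCoreSiteBound :
    ¬ ∀ (N : ℕ) (x : Fin N → EuclideanSpace ℝ (Fin 3)), Function.Injective x → (∀ i j, i ≠ j → (9 / 10 : ℝ) ≤ dist (x i) (x j)) →
      ∀ i, -(2 * cS) ≤ siteEnergy gS x i := by
  intro h
  obtain ⟨x, hx, hsep, hE⟩ := exists_star_of_shell (p := 9) (q := 10)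
    (![![2384, -1507, -568],
        ![270, 3369, -4358],
        ![-2486, -338, -3883],
        ![3636, 3152, 2271],
        ![2046, -1434, -5357],
        ![17, 250, 830],
        ![3053, -1232, 3116],
        ![-3564, 3168, -1527],
        ![3820, 1599, -1968],
        ![-3003, 1232, 2076],
        ![-3938, -1754, -19],
        ![-2460, -2772, 4490],
        ![-778, 4885, 1750],
        ![-1091, -4602, -2766],
        ![298, -1414, 455]] : Fin 15 → Fin 3 → ℤ)
    (![2877, 5515, 4623, 5321, 5911, 867, 4533, 5007, 4585, 3853, 4311, 5822, 5247, 5479, 1515] : Fin 15 → ℕ)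
    (by norm_num) (by norm_num) (by norm_num) (by decide) (by decide) (by decide)
  have h0 := h 16 x hx (fun i j hij => by have := hsep i j hij; norm_num at this; exact this) 0
  rw [hE, cS_eq] at h0
  have hg := gS_one_le
  norm_num at h0
  linarith

/-- Monotonicity in the hard core: no `δ ≤ 9/10` helps either. [folklore] -/
theorem not_hardCoreSiteBound_of_le {δ : ℝ} (hδ : δ ≤ 9 / 10) :
    ¬ ∀ (N : ℕ) (x : Fin N → EuclideanSpace ℝ (Fin 3)), Function.Injective x → (∀ i j, i ≠ j → δ ≤ dist (x i) (x j)) →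
      ∀ i, -(2 * cS) ≤ siteEnergy gS x i :=
  fun h => not_hardCoreSiteBound fun N x hx hsep i => h N x hx (fun i j hij => hδ.trans (hsep i j hij)) i

end Summit.AtomisticToContinuum.Crystallization.Theorems.StubLocal
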